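import Mathlib.Analysis.SpecialFunctions.Pow.Real
import HarnessLib

/-!
# RiemannHypothesis / GroundBarta — crux `PolarPerronFrobenius` (stmt-RiemannHypothesis-18390):
# NEGATIVE knowledge — strict parity INTERLACING does not rescue Perron–Frobenius under a positive rank-one push

Negative-side helper file of the standing disprover (`--supports stmt-RiemannHypothesis-18390`; lane
`Theorems/PolarPerronFrobenius/Negative/`), RH-free, Mathlib only, no definitions, no named facts, no sorry.

Context.  The crux's matrix at a window is `EW(a) → GSP(a)` for the windowed Weil form
`Re Q = 2|⟨·,cosh(t/2)⟩|² + 𝓔_a − M_a‖·‖²` (`𝓔_a` a reflection-symmetric Markovian jump form with a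
Perron–Frobenius bottom; the polar push is rank-one along the POSITIVE EVEN vector `cosh(t/2)` and vanishes
on the odd sector).  `NotPolarPerronFrobenius.lean` (`toy_rankOne_not_oneSigned`, dim 2) showed the push can
destroy one-signedness; `EvenWinsNotOneSignedToy.lean` (`toy_evenWins_not_oneSigned`, dim 4) showed that the
guard "even wins" does not prevent it — but THERE the failure came from a level-order defect of the unperturbed
form (its second even level lay below its first odd level), and the disprover's numerics for the Weil form
(`Cruxes/PolarPerronFrobenius/Disproof.lean`, F5) show the opposite, strict interlacing
`ε_ev,1 < ε_od,1 < ε_ev,2` by factors `10³`/`10⁶`.  This file closes that loophole too: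

`toy_interlacing_not_oneSigned` — nodes `1,2,3,4`, reflection `σ = (1 4)(2 3)` (outer orbit `{1,4}`, inner
orbit `{2,3}`); `M` symmetric, `σ`-invariant, ALL off-diagonal entries `< 0` (`M₁₂=M₁₃=M₂₄=M₃₄=M₂₃=−1`,
`M₁₄=−7/4`; diagonal `M₁₁=M₄₄=−9/4`, `M₂₂=M₃₃=0`), so `e^{−tM}` is positivity improving.  Its levels are
RATIONAL and INTERLACE STRICTLY by parity: even `−5` (Perron–Frobenius vector `(2,1,1,2)/√10 > 0`), odd `−1/2`
(`(1,0,0,−1)/√2`), even `0` (`(1,−2,−2,1)/√10`), odd `1` (`(0,1,−1,0)/√2`) — parts 1–2.  Push along the positive,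
even, constant `c = (1,1,1,1)`: `H = M + 2ccᵀ`.  Then (part 3) the push vanishes on the odd sector, so the odd
bottom of `H` is still `−1/2`; (part 4) `q_H ≥ −‖x‖²` with equality EXACTLY on the line of the even MIXED-SIGN
vector `(2,−1,−1,2)/√10`: the even sector wins strictly (`−1 < −1/2`), the bottom is simple, and the ground
state changes sign (the inner orbit flips); (part 5) every entrywise non-negative vector has `q_H ≥ −‖x‖²/4`,
far from the bottom.  Part 6 is the BIRTH of the sign change along the coupling homotopy `M + (k/2)ccᵀ`
(idea card `coupling-birth-locus`): at half push (`k = 2`) the bottom `−2` is attained exactly on the line of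
`(1,0,0,1)/√2` — non-negative but VANISHING on the inner orbit — while even still wins (`−2 < −1/2`); beyond it
the inner orbit turns negative.

MORAL (what a proof of the crux must use beyond every SPECTRAL hypothesis one can name — positivity
improvement, reflection symmetry, positive even push, strict even-winning, strict parity interlacing with
large gaps): the sign of the perturbed bottom is decided by eigenvector SHAPE.  In the even sector the push
adds `+4c₁c₂` to the (negative, "ferromagnetic") Markov coupling `β+γ = −2` between the two `σ`-orbits; once
the net inter-orbit coupling is positive (`k > 2`) the even ground vector anti-aligns the orbits, and it is the
orbit carrying the SMALL component of the Perron–Frobenius vector (the inner one, higher diagonal energy) that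
flips.  For the Weil window form the analogue is the competition, between the bulk and the `Φ(a)`-thin edge
region, of the jump-kernel transport `w(|s−t|) = e^{|s−t|/2}/(2 sinh|s−t|)` (`≈ 1` at distance `≈ a`) against
the polar push `2cosh(s/2)cosh(t/2)` (`≈ e^{a/2}` between centre and edge): the DIRECT long-range Markov
coupling loses for large `a`, so one-signedness can only come from multi-step short-range transport (the
potential theory of the logarithmic edge layer, Disproof.lean F4/F4c) — a quantitative property of `𝓔_a`, not a
consequence of its Markov structure or of the parity order of levels.  Refuter
`refuter-cdisprove-stmt-RiemannHypothesis-18390-g2-0` (cdisprove gen 2).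
-/

set_option linter.dupNamespace false

noncomputable section

namespace Summit.RiemannHypothesis.RiemannHypothesis.Theorems.PolarPerronFrobenius.Negative

/-- **Strict parity interlacing, Perron–Frobenius input intact, positive constant rank-one push, even wins —
and the ground state changes sign.**  With
`q_M(x) = −(9/4)(x₁²+x₄²) − 2(x₁x₂+x₁x₃+x₂x₄+x₃x₄) − (7/2)x₁x₄ − 2x₂x₃` (the form of the `σ`-symmetric `M`
with all off-diagonal entries negative, `σ = (1 4)(2 3)`) and `q_H = q_M + 2⟨c,x⟩²`, `c = (1,1,1,1)`:
1. (PF input) `q_M ≥ −5‖x‖²`, with equality at the positive even vector `(2,1,1,2)` and only on its line;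
2. (strict parity interlacing of `M`: `−5 < −1/2 < 0 < 1`) on the odd sector (`x₄=−x₁`, `x₃=−x₂`)
   `q_M = −x₁²+2x₂² ≥ −½‖x‖²`, bottom `−1/2` at `(1,0,0,−1)`, and `q_M = ‖x‖²` on the odd line `(0,1,−1,0)`
   orthogonal to it; on the even line `(1,−2,−2,1)` orthogonal to the PF vector `q_M = 0`;
3. (odd sector untouched) `q_H = q_M` on odd vectors, so the odd bottom of `H` is `−1/2`;
4. (even wins strictly, sign-changing simple bottom) `q_H ≥ −‖x‖²`, with equality at the even mixed-sign
   vector `(2,−1,−1,2)` and only on its line;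
5. (no one-signed ground state) every entrywise non-negative `x` has `q_H(x) ≥ −‖x‖²/4`;
6. (birth of the sign change at half push) `q_M + ⟨c,x⟩² ≥ −2‖x‖²`, with equality exactly on the line of
   `(1,0,0,1)`: non-negative, vanishing on the inner orbit, even still winning (`−2 < −1/2`). [folklore] -/
theorem toy_interlacing_not_oneSigned :
    -- 1. Perron–Frobenius input: bottom of `M` is `−5`, exactly on the line of the positive even vector (2,1,1,2)
    ((∀ x₁ x₂ x₃ x₄ : ℝ, -(5 : ℝ) * (x₁ ^ 2 + x₂ ^ 2 + x₃ ^ 2 + x₄ ^ 2) ≤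
        -(9 / 4) * (x₁ ^ 2 + x₄ ^ 2) - 2 * (x₁ * x₂ + x₁ * x₃ + x₂ * x₄ + x₃ * x₄) - (7 / 2) * (x₁ * x₄) -
          2 * (x₂ * x₃)) ∧
      (-(9 / 4 : ℝ) * (2 ^ 2 + 2 ^ 2) - 2 * (2 * 1 + 2 * 1 + 1 * 2 + 1 * 2) - (7 / 2) * (2 * 2) - 2 * (1 * 1) =
        -5 * (2 ^ 2 + 1 ^ 2 + 1 ^ 2 + 2 ^ 2)) ∧
      (∀ x₁ x₂ x₃ x₄ : ℝ,
        -(9 / 4 : ℝ) * (x₁ ^ 2 + x₄ ^ 2) - 2 * (x₁ * x₂ + x₁ * x₃ + x₂ * x₄ + x₃ * x₄) - (7 / 2) * (x₁ * x₄) -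
            2 * (x₂ * x₃) = -5 * (x₁ ^ 2 + x₂ ^ 2 + x₃ ^ 2 + x₄ ^ 2) →
          x₄ = x₁ ∧ x₃ = x₂ ∧ x₁ = 2 * x₂)) ∧
    -- 2. strict parity interlacing of `M`: odd sector form, odd bottom −1/2 at (1,0,0,−1), odd level 1 at
    --    (0,1,−1,0), even level 0 at (1,−2,−2,1) ⟂ PF vector
    ((∀ x₁ x₂ : ℝ,
        -(9 / 4 : ℝ) * (x₁ ^ 2 + (-x₁) ^ 2) - 2 * (x₁ * x₂ + x₁ * (-x₂) + x₂ * (-x₁) + (-x₂) * (-x₁)) -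
            (7 / 2) * (x₁ * (-x₁)) - 2 * (x₂ * (-x₂)) = -x₁ ^ 2 + 2 * x₂ ^ 2 ∧
          -(1 / 2 : ℝ) * (x₁ ^ 2 + x₂ ^ 2 + (-x₂) ^ 2 + (-x₁) ^ 2) ≤ -x₁ ^ 2 + 2 * x₂ ^ 2) ∧
      (-(1 : ℝ) ^ 2 + 2 * 0 ^ 2 = -(1 / 2) * (1 ^ 2 + 0 ^ 2 + (-0) ^ 2 + (-1) ^ 2)) ∧
      (∀ x₂ : ℝ, -(0 : ℝ) ^ 2 + 2 * x₂ ^ 2 = 1 * (0 ^ 2 + x₂ ^ 2 + (-x₂) ^ 2 + (-0) ^ 2)) ∧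
      (∀ x₁ : ℝ,
        -(9 / 4 : ℝ) * (x₁ ^ 2 + x₁ ^ 2) -
              2 * (x₁ * (-2 * x₁) + x₁ * (-2 * x₁) + (-2 * x₁) * x₁ + (-2 * x₁) * x₁) - (7 / 2) * (x₁ * x₁) -
            2 * ((-2 * x₁) * (-2 * x₁)) = 0)) ∧
    -- 3. the push `2⟨c,x⟩²`, `c = (1,1,1,1)`, vanishes on the odd sector
    (∀ x₁ x₂ : ℝ, 2 * (x₁ + x₂ + (-x₂) + (-x₁)) ^ 2 = (0 : ℝ)) ∧
    -- 4. even wins strictly: global bottom of `q_H = q_M + 2⟨c,x⟩²` is `−1 < −1/2`, exactly on the line of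
    --    the even mixed-sign vector (2,−1,−1,2)
    ((∀ x₁ x₂ x₃ x₄ : ℝ, -(1 : ℝ) * (x₁ ^ 2 + x₂ ^ 2 + x₃ ^ 2 + x₄ ^ 2) ≤
        -(9 / 4) * (x₁ ^ 2 + x₄ ^ 2) - 2 * (x₁ * x₂ + x₁ * x₃ + x₂ * x₄ + x₃ * x₄) - (7 / 2) * (x₁ * x₄) -
            2 * (x₂ * x₃) + 2 * (x₁ + x₂ + x₃ + x₄) ^ 2) ∧
      (-(9 / 4 : ℝ) * (2 ^ 2 + 2 ^ 2) - 2 * (2 * (-1) + 2 * (-1) + (-1) * 2 + (-1) * 2) - (7 / 2) * (2 * 2) -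
            2 * ((-1) * (-1)) + 2 * (2 + (-1) + (-1) + 2) ^ 2 =
        -1 * (2 ^ 2 + (-1) ^ 2 + (-1) ^ 2 + 2 ^ 2)) ∧
      (∀ x₁ x₂ x₃ x₄ : ℝ,
        -(9 / 4 : ℝ) * (x₁ ^ 2 + x₄ ^ 2) - 2 * (x₁ * x₂ + x₁ * x₃ + x₂ * x₄ + x₃ * x₄) - (7 / 2) * (x₁ * x₄) -
              2 * (x₂ * x₃) + 2 * (x₁ + x₂ + x₃ + x₄) ^ 2 = -1 * (x₁ ^ 2 + x₂ ^ 2 + x₃ ^ 2 + x₄ ^ 2) →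
          x₄ = x₁ ∧ x₃ = x₂ ∧ x₁ = -2 * x₂)) ∧
    -- 5. no non-negative vector comes near the bottom
    (∀ x₁ x₂ x₃ x₄ : ℝ, 0 ≤ x₁ → 0 ≤ x₂ → 0 ≤ x₃ → 0 ≤ x₄ →
        -(1 / 4 : ℝ) * (x₁ ^ 2 + x₂ ^ 2 + x₃ ^ 2 + x₄ ^ 2) ≤
          -(9 / 4) * (x₁ ^ 2 + x₄ ^ 2) - 2 * (x₁ * x₂ + x₁ * x₃ + x₂ * x₄ + x₃ * x₄) - (7 / 2) * (x₁ * x₄) -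
              2 * (x₂ * x₃) + 2 * (x₁ + x₂ + x₃ + x₄) ^ 2) ∧
    -- 6. birth of the sign change at half push: bottom of `q_M + ⟨c,x⟩²` is `−2 < −1/2`, exactly on the
    --    line of (1,0,0,1) — non-negative, vanishing on the inner orbit {2,3}
    ((∀ x₁ x₂ x₃ x₄ : ℝ, -(2 : ℝ) * (x₁ ^ 2 + x₂ ^ 2 + x₃ ^ 2 + x₄ ^ 2) ≤
        -(9 / 4) * (x₁ ^ 2 + x₄ ^ 2) - 2 * (x₁ * x₂ + x₁ * x₃ + x₂ * x₄ + x₃ * x₄) - (7 / 2) * (x₁ * x₄) -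
            2 * (x₂ * x₃) + (x₁ + x₂ + x₃ + x₄) ^ 2) ∧
      (∀ x₁ x₂ x₃ x₄ : ℝ,
        -(9 / 4 : ℝ) * (x₁ ^ 2 + x₄ ^ 2) - 2 * (x₁ * x₂ + x₁ * x₃ + x₂ * x₄ + x₃ * x₄) - (7 / 2) * (x₁ * x₄) -
              2 * (x₂ * x₃) + (x₁ + x₂ + x₃ + x₄) ^ 2 = -2 * (x₁ ^ 2 + x₂ ^ 2 + x₃ ^ 2 + x₄ ^ 2) ↔
          x₄ = x₁ ∧ x₂ = 0 ∧ x₃ = 0)) := by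
  refine ⟨⟨fun x₁ x₂ x₃ x₄ ↦ ?_, by norm_num, fun x₁ x₂ x₃ x₄ h ↦ ?_⟩,
    ⟨fun x₁ x₂ ↦ ⟨by ring, ?_⟩, by norm_num, fun x₂ ↦ by ring, fun x₁ ↦ by ring⟩,
    fun x₁ x₂ ↦ by ring, ⟨fun x₁ x₂ x₃ x₄ ↦ ?_, by norm_num, fun x₁ x₂ x₃ x₄ h ↦ ?_⟩,
    fun x₁ x₂ x₃ x₄ h₁ h₂ h₃ h₄ ↦ ?_, ⟨fun x₁ x₂ x₃ x₄ ↦ ?_, fun x₁ x₂ x₃ x₄ ↦ ⟨fun h ↦ ?_, fun h ↦ ?_⟩⟩⟩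
  · -- SOS: q_M + 5‖x‖² = ½(x₁−2x₂−2x₃+x₄)² + (9/4)(x₁−x₄)² + 3(x₂−x₃)²
    have key : -(9 / 4 : ℝ) * (x₁ ^ 2 + x₄ ^ 2) - 2 * (x₁ * x₂ + x₁ * x₃ + x₂ * x₄ + x₃ * x₄) -
        (7 / 2) * (x₁ * x₄) - 2 * (x₂ * x₃) + 5 * (x₁ ^ 2 + x₂ ^ 2 + x₃ ^ 2 + x₄ ^ 2) =
        (1 / 2) * (x₁ - 2 * x₂ - 2 * x₃ + x₄) ^ 2 + (9 / 4) * (x₁ - x₄) ^ 2 + 3 * (x₂ - x₃) ^ 2 := by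
      ring
    linarith [sq_nonneg (x₁ - 2 * x₂ - 2 * x₃ + x₄), sq_nonneg (x₁ - x₄), sq_nonneg (x₂ - x₃)]
  · have hsos : (1 / 2 : ℝ) * (x₁ - 2 * x₂ - 2 * x₃ + x₄) ^ 2 + (9 / 4) * (x₁ - x₄) ^ 2 +
        3 * (x₂ - x₃) ^ 2 = 0 := by
      linear_combination h
    have hA := sq_nonneg (x₁ - 2 * x₂ - 2 * x₃ + x₄)
    have hB := sq_nonneg (x₁ - x₄)
    have hC := sq_nonneg (x₂ - x₃)
    have e14 : x₁ - x₄ = 0 := pow_eq_zero_iff (n := 2) (by norm_num) |>.1 (by linarith)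
    have e23 : x₂ - x₃ = 0 := pow_eq_zero_iff (n := 2) (by norm_num) |>.1 (by linarith)
    have es : x₁ - 2 * x₂ - 2 * x₃ + x₄ = 0 := pow_eq_zero_iff (n := 2) (by norm_num) |>.1 (by linarith)
    exact ⟨by linarith, by linarith, by linarith⟩
  · -- odd sector: −x₁² + 2x₂² ≥ −(x₁² + x₂²)
    have key : (x₁ ^ 2 + x₂ ^ 2 + (-x₂) ^ 2 + (-x₁) ^ 2 : ℝ) = 2 * x₁ ^ 2 + 2 * x₂ ^ 2 := by ring
    rw [key]
    nlinarith [sq_nonneg x₁, sq_nonneg x₂]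
  · -- SOS: q_H + ‖x‖² = ½(x₁+2x₂+2x₃+x₄)² + ¼(x₁−x₄)² + (x₂−x₃)²
    have key : -(9 / 4 : ℝ) * (x₁ ^ 2 + x₄ ^ 2) - 2 * (x₁ * x₂ + x₁ * x₃ + x₂ * x₄ + x₃ * x₄) -
        (7 / 2) * (x₁ * x₄) - 2 * (x₂ * x₃) + 2 * (x₁ + x₂ + x₃ + x₄) ^ 2 +
        1 * (x₁ ^ 2 + x₂ ^ 2 + x₃ ^ 2 + x₄ ^ 2) =
        (1 / 2) * (x₁ + 2 * x₂ + 2 * x₃ + x₄) ^ 2 + (1 / 4) * (x₁ - x₄) ^ 2 + (x₂ - x₃) ^ 2 := by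
      ring
    linarith [sq_nonneg (x₁ + 2 * x₂ + 2 * x₃ + x₄), sq_nonneg (x₁ - x₄), sq_nonneg (x₂ - x₃)]
  · have hsos : (1 / 2 : ℝ) * (x₁ + 2 * x₂ + 2 * x₃ + x₄) ^ 2 + (1 / 4) * (x₁ - x₄) ^ 2 +
        (x₂ - x₃) ^ 2 = 0 := by
      linear_combination h
    have hA := sq_nonneg (x₁ + 2 * x₂ + 2 * x₃ + x₄)
    have hB := sq_nonneg (x₁ - x₄)
    have hC := sq_nonneg (x₂ - x₃)
    have e14 : x₁ - x₄ = 0 := pow_eq_zero_iff (n := 2) (by norm_num) |>.1 (by linarith)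
    have e23 : x₂ - x₃ = 0 := pow_eq_zero_iff (n := 2) (by norm_num) |>.1 (by linarith)
    have es : x₁ + 2 * x₂ + 2 * x₃ + x₄ = 0 := pow_eq_zero_iff (n := 2) (by norm_num) |>.1 (by linarith)
    exact ⟨by linarith, by linarith, by linarith⟩
  · -- for x ≥ 0: q_H + ¼‖x‖² = (9/4)(x₂²+x₃²) + 2(x₁x₂+x₁x₃+x₂x₄+x₃x₄+x₂x₃) + ½x₁x₄ has non-negative terms
    have key : -(9 / 4 : ℝ) * (x₁ ^ 2 + x₄ ^ 2) - 2 * (x₁ * x₂ + x₁ * x₃ + x₂ * x₄ + x₃ * x₄) -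
        (7 / 2) * (x₁ * x₄) - 2 * (x₂ * x₃) + 2 * (x₁ + x₂ + x₃ + x₄) ^ 2 +
        (1 / 4) * (x₁ ^ 2 + x₂ ^ 2 + x₃ ^ 2 + x₄ ^ 2) =
        (9 / 4) * (x₂ ^ 2 + x₃ ^ 2) + 2 * (x₁ * x₂ + x₁ * x₃ + x₂ * x₄ + x₃ * x₄ + x₂ * x₃) +
          (1 / 2) * (x₁ * x₄) := by
      ring
    linarith [mul_nonneg h₁ h₂, mul_nonneg h₁ h₃, mul_nonneg h₁ h₄, mul_nonneg h₂ h₃, mul_nonneg h₂ h₄,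
      mul_nonneg h₃ h₄, sq_nonneg x₂, sq_nonneg x₃]
  · -- SOS: q_M + ⟨c,x⟩² + 2‖x‖² = (3/2)(x₂+x₃)² + ¾(x₁−x₄)² + (3/2)(x₂−x₃)²
    have key : -(9 / 4 : ℝ) * (x₁ ^ 2 + x₄ ^ 2) - 2 * (x₁ * x₂ + x₁ * x₃ + x₂ * x₄ + x₃ * x₄) -
        (7 / 2) * (x₁ * x₄) - 2 * (x₂ * x₃) + (x₁ + x₂ + x₃ + x₄) ^ 2 +
        2 * (x₁ ^ 2 + x₂ ^ 2 + x₃ ^ 2 + x₄ ^ 2) =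
        (3 / 2) * (x₂ + x₃) ^ 2 + (3 / 4) * (x₁ - x₄) ^ 2 + (3 / 2) * (x₂ - x₃) ^ 2 := by
      ring
    linarith [sq_nonneg (x₂ + x₃), sq_nonneg (x₁ - x₄), sq_nonneg (x₂ - x₃)]
  · have hsos : (3 / 2 : ℝ) * (x₂ + x₃) ^ 2 + (3 / 4) * (x₁ - x₄) ^ 2 + (3 / 2) * (x₂ - x₃) ^ 2 = 0 := by
      linear_combination h
    have hA := sq_nonneg (x₂ + x₃)
    have hB := sq_nonneg (x₁ - x₄)
    have hC := sq_nonneg (x₂ - x₃)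
    have e14 : x₁ - x₄ = 0 := pow_eq_zero_iff (n := 2) (by norm_num) |>.1 (by linarith)
    have e23 : x₂ - x₃ = 0 := pow_eq_zero_iff (n := 2) (by norm_num) |>.1 (by linarith)
    have es : x₂ + x₃ = 0 := pow_eq_zero_iff (n := 2) (by norm_num) |>.1 (by linarith)
    exact ⟨by linarith, by linarith, by linarith⟩
  · obtain ⟨h4, h2, h3⟩ := h
    subst h4 h2 h3
    ring

end Summit.RiemannHypothesis.RiemannHypothesis.Theorems.PolarPerronFrobenius.Negative

end
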